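import Summits.BirchSwinnertonDyer.BirchSwinnertonDyer.Theorems.ResidualThetaTransportAtTwoRlfOfIsoDoor
import Summits.BirchSwinnertonDyer.BirchSwinnertonDyer.Theorems.ResidualThetaTransportAtTwoRlfStubIsoOfLayerIso
import Summits.BirchSwinnertonDyer.BirchSwinnertonDyer.Theorems.ResidualThetaTransportAtTwoRlfLayerIsoAssembly
import HarnessLib

/-!
# Route `ResidualThetaTransportAtTwo` (RTT P6, item stmt-BirchSwinnertonDyer-23110 `ResidualLambdaFormulaNegDiscAtTwo`):
# the crux from the two PRINT facts ALONE — the isotropy `hiso` (B. D. Kim 2007 Prop. 3.15/4.11 at `2`) is DISCHARGED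

Width seat `bsd-wall-tp2-p2x-w2` g16 (cell `bsd-wall`), for the LEAD `bsd-wall-tp2-p2x` g13 (item claimed; skeleton `hplusdual`).
HONEST FRAMING: THEOREMS ONLY; CONDITIONAL on the two named PRINT facts `Greenberg1999.h1SigmaInfty_rank_eq_one` (weak Leopoldt
at `2`, Kato) and `Greenberg1999.prop412_noFiniteSubmodule_H1Sigma_of_rank_one` (Greenberg Prop. 4.12 at `2`) — the stubs
`stub_hWL`, `stub_h412` of the skeleton; the third stub `stub_iso` is PROVED in the tree
(`TwistedLocalKummer.stub_iso_of_layerIso` ∘ `LayerIsoAssembly.layerIso`). 23110 is therefore CLOSED MODULO PRINT, not proved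
outright; BSD is NOT proved by any of this.

* **`residualLambdaFormulaNegDiscAtTwo_of_print`** `(hWL) (h412) : Theses.ResidualThetaTransportAtTwo.ResidualLambdaFormulaNegDiscAtTwo`;
* **`residualLambdaFormulaNegDiscAtTwo_TP2_of_print`** — the `ThetaPartnerAtTwo` twin (identical statement).

Chain: door `residualLambdaFormulaNegDiscAtTwo_of_print_of_iso` (p669416: twisted descent, LIFT⁺₂, H-FIN, (TCAS-K)_ev, K1/K3/K4
counting) ∘ `stub_iso_of_layerIso` (COR-SURJ p676035, untwisting p673008, top projection formula p671285, PT-dialect link) ∘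
`LayerIsoAssembly.layerIso` (layer dictionary + θ-extraction `forall_layerForm_eq_zero_two` + (d′) + ISO-1c + (R1)@2).

References: B. D. Kim, Compositio Math. 143 (2007), Props. 3.15, 3.17, 3.18, 4.11 [BDKim2007]; R. Greenberg, LNM 1716 (1999), §4
Prop. 4.12–4.14, §5 p. 140 [GreenbergLNM1716]; K. Kato, Astérisque 295 (2004), Thm. 12.4 [Kato2004Asterisque]; S. Kobayashi,
Invent. math. 152 (2003), Thm. 1.2 [Kobayashi2003].
-/

-- the Theorems namespace of this sub repeats the summit name by design (D-0017 nested layout)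
set_option linter.dupNamespace false

noncomputable section

namespace Summit.BirchSwinnertonDyer.BirchSwinnertonDyer.Theorems.SignedEC.TwistedLocalDescent

open Literature.NumberTheory.EllipticCurves

/-- **RTT P6 `ResidualLambdaFormulaNegDiscAtTwo` from PRINT alone**: weak Leopoldt at `2` (`hWL`) and Greenberg's Prop. 4.12 at
`2` (`h412`) imply the route statement — the isotropy input `hiso` of the door is a theorem
(`stub_iso_of_layerIso` with `LayerIsoAssembly.layerIso`). [cite: BDKim2007, Props. 3.15, 4.11] [cite: GreenbergLNM1716, §4 Prop. 4.12]
[cite: Kato2004Asterisque, Thm. 12.4] -/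
theorem residualLambdaFormulaNegDiscAtTwo_of_print
    (hWL : Greenberg1999.h1SigmaInfty_rank_eq_one)
    (h412 : Greenberg1999.prop412_noFiniteSubmodule_H1Sigma_of_rank_one) :
    Summit.BirchSwinnertonDyer.BirchSwinnertonDyer.Theses.ResidualThetaTransportAtTwo.ResidualLambdaFormulaNegDiscAtTwo :=
  residualLambdaFormulaNegDiscAtTwo_of_print_of_iso hWL h412
    (TwistedLocalKummer.stub_iso_of_layerIso fun E _ _ hss ha _ hκ ↦ LayerIsoAssembly.layerIso E hss ha hκ)

/-- **The `ThetaPartnerAtTwo` twin** (identical statement text). [cite: BDKim2007, Props. 3.15, 4.11] [cite: GreenbergLNM1716, §4 Prop. 4.12] -/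
theorem residualLambdaFormulaNegDiscAtTwo_TP2_of_print
    (hWL : Greenberg1999.h1SigmaInfty_rank_eq_one)
    (h412 : Greenberg1999.prop412_noFiniteSubmodule_H1Sigma_of_rank_one) :
    Summit.BirchSwinnertonDyer.BirchSwinnertonDyer.Theses.ThetaPartnerAtTwo.ResidualLambdaFormulaNegDiscAtTwo :=
  residualLambdaFormulaNegDiscAtTwo_TP2_of_print_of_iso hWL h412
    (TwistedLocalKummer.stub_iso_of_layerIso fun E _ _ hss ha _ hκ ↦ LayerIsoAssembly.layerIso E hss ha hκ)

end Summit.BirchSwinnertonDyer.BirchSwinnertonDyer.Theorems.SignedEC.TwistedLocalDescent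

end
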